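import Summits.CriticalPhenomena.PercolationContinuityZ3.Theorems.Transplant.SkelFrmBChoiceCreepY3
import HarnessLib

/-!
# N2 (frames-only node `SamePDropOfSkeletonFrm₁`, OPEN) — (ζ″) ledger, (R) column input: **THE x-READING OF THE (C) y′ ARRIVAL BOX IS NARROW, AND HOW A WIDENED
# BOX MOVES ITS AXIS-0 READINGS** (part 1 of the (R-YA) root reading row; part 2 = SkelFrmBChoiceRootReadRowsY)

The x-reading of the (C) y′ arrival box `[arrLoY3, arrHiY3]` (SkelFrmBChoiceCreepY3) was landed as `rdHi₀ − rdLo₀ ≤ 152·s₀ − 3` (`rd0Y_bounds_3`) — the whole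
window `2·76·s₀`; its integer core in fact certifies `Ap − Am ≤ 92·nΔ`, i.e. width `< 95·s₀` (§1 the core with the tight conclusion, §2 its instantiation at the
tuple of record, verbatim the landed one); §3: widening a box by `n·e` below / above moves the axis-0 readings by `k` fine cells when `c₀'·A·e = k·D`
(pure shift lemmas over `Skelφ.rdLo/rdHi`, used by part 2 with `c₀'·A·Δ = s₀·D`).
* §1 `creepY_core3_width`; §2 `rd0Y_width_3` (`rdHi₀ − rdLo₀ ≤ 95·s₀ − 1`); §3 `rdLo_zero_widen`, `rdHi_zero_widen`.
NON-VACUITY (lead g11 standing order 03:52:56Z): value rows at the closed tuple; binder set = `hLtY_3`'s (`hKq`, `hN`, `hg`, `hg2`).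
builds on p205010 (kernel theorem, internal audit signed; external expert review pending) — nothing in this file uses p205010; NOTHING is claimed about the open
node `SamePDropOfSkeletonFrm₁`.
Lane `prim-bschramm`, seat `prim-bschramm-stmt` (gen 22); helper file (`--supports stmt-CriticalPhenomena-4575 --as helper`).
[cite: KozmaNitzan2024, §4 p. 28 ((32) at the root), Lemma 12 (pp. 23–25)] [cite: MartineauTassion2017, §4.1, §4.3 Lemma 4.2]
-/

open scoped Classical

noncomputable section

namespace Summit.CriticalPhenomena.PercolationContinuityZ3.Theorems.Transplant

namespace PlanarSkeletonFrm

namespace NegB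

open Literature.Probability.Percolation Literature.Probability.LatticeModels SimpleGraph
open Literature.Probability.Percolation.KozmaNitzan.Cells (oth)
open SkelConc (Consts)
open Skelφ (shearUnit kgSL kgSLY kgM₁Y kgM₂Y kgE₁Y kgXY kgCtr2Y kgHw2Y kgA₁Yp kgT₁Y kgTY kgDec₁Y kgDec₂Y dS rdLo rdHi KGYRows)
open TwoAxis.Para (modulus)
open Neg

/-! ## §1 The tight pure-integer width core -/

/-- **The pure-integer core of the y-step creep rows, TIGHT WIDTH**: same hypotheses as the landed `creepY_core3` (SkelFrmBChoiceCreepYCore3) minus the two unused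
floors, conclusion `Fp + 1 − Fm ≤ 95·s₀ − 1` (the landed core states the generous `152·s₀ − 3`; internally `Ap − Am ≤ 92·nΔ`, and the two floors cost
`s₀·n + 2nΔ ≤ 3·s₀·nΔ`). [folklore] -/
theorem creepY_core3_width
    {n U Δ s K R v av N a₁ a₂ E₁ XY P₀ H C lo₀ hi₀ lo₁ G T₁ T₂ Am Ap s₀ Fm Fp : ℤ}
    (hn : 1 ≤ n) (hUn : n ≤ U) (hUs : U * s ≤ Δ) (hΔU : Δ ≤ U * s + 2 * U) (hs : 958 ≤ s) (hK : 100 ≤ K) (hR : 1 ≤ R)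
    (hKR : 40 * K * R ≤ s + 1) (hnR : 40 * K * R + 1 ≤ n)
    (hav0 : 0 ≤ av) (havn : av ≤ n) (hv1 : v ≤ av) (hv2 : -v ≤ av)
    (hN0 : 0 ≤ N) (hN : N ≤ 21 * K + 2) (ha1 : 194 ≤ a₁) (ha1' : a₁ ≤ 198) (ha2 : 1 ≤ a₂) (ha2' : a₂ ≤ 42)
    (hE0 : 2 * (n + av) ≤ E₁) (hE1 : E₁ ≤ 5 * n) (hXY0 : 0 ≤ XY) (hXY : XY ≤ 22 * s) (hP0 : s ≤ P₀) (hP1 : P₀ ≤ s + 1)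
    (hH : H = E₁ + 2 * a₂ * (R + av)) (hC : C = 2 * (N + 1) * v - 2 * v + a₁ * n)
    (hlo0 : C - H ≤ 2 * lo₀) (hlo0' : 2 * lo₀ ≤ C - H + 1) (hhi0 : 2 * hi₀ ≤ C + H) (hhi0' : C + H - 1 ≤ 2 * hi₀)
    (hlo1 : lo₁ = (N + 1) * s + XY - P₀) (hG : G = U * P₀ + U - 1)
    (hT₁ : T₁ = v * (U * lo₁)) (hT₂ : T₂ = T₁ + v * G) (hAm : Am = Δ * lo₀ - max T₁ T₂) (hAp : Ap = Δ * hi₀ - min T₁ T₂)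
    (hs0 : 1 ≤ s₀) (hF2 : s₀ * (Am - n) - n * Δ < n * Δ * Fm) (hF3 : n * Δ * Fp ≤ s₀ * Ap) :
    Fp + 1 - Fm ≤ 95 * s₀ - 1 := by
  -- basic positivity
  have hU0 : 0 < U := by linarith
  have hn0 : 0 < n := by linarith
  have hs0p : 0 < s₀ := by linarith
  have hUs958 : 958 * U ≤ U * s := by have := mul_le_mul_of_nonneg_left hs hU0.le; linarith
  have hUΔ : 958 * U ≤ Δ := hUs958.trans hUs
  have hΔ0 : 0 < Δ := by linarith
  have hK40 : 40 * K ≤ s + 1 := by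
    have : 40 * K * 1 ≤ 40 * K * R := mul_le_mul_of_nonneg_left hR (by linarith)
    linarith
  have hKU : 40 * (K * U) ≤ Δ + U := by
    have := mul_le_mul_of_nonneg_right hK40 hU0.le
    linarith
  have hRn : 40 * K * R ≤ n := by linarith
  -- the drift residue `d := Δ − U s ∈ [0, 2U]`
  have hd0 : 0 ≤ Δ - U * s := by linarith
  have hd1 : Δ - U * s ≤ 2 * U := by linarith
  have hvabs : |v| ≤ av := abs_le.2 ⟨by linarith, hv1⟩
  have hvn0 : |v| ≤ n := hvabs.trans havn
  have hG0 : 0 ≤ G := by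
    have : U * s ≤ U * P₀ := mul_le_mul_of_nonneg_left hP0 hU0.le
    rw [hG]; linarith
  -- max/min of the two drift terms: `T₂ − T₁ = v·G`, `G ≥ 0`
  have hMd : max T₁ T₂ - min T₁ T₂ ≤ av * G := by
    rcases le_total T₁ T₂ with h12 | h12
    · rw [max_eq_right h12, min_eq_left h12, hT₂]
      have : v * G ≤ av * G := mul_le_mul_of_nonneg_right hv1 hG0
      linarith
    · rw [max_eq_left h12, min_eq_right h12, hT₂]
      have : -v * G ≤ av * G := mul_le_mul_of_nonneg_right hv2 hG0
      linarith
  have hMs : max T₁ T₂ + min T₁ T₂ = 2 * (v * (U * lo₁)) + v * G := by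
    rcases le_total T₁ T₂ with h12 | h12
    · rw [max_eq_right h12, min_eq_left h12, hT₂, hT₁]; ring
    · rw [max_eq_left h12, min_eq_right h12, hT₂, hT₁]; ring
  generalize max T₁ T₂ = Mp at hMd hMs hAm hAp
  generalize min T₁ T₂ = Mm at hMd hMs hAm hAp
  -- (1) the box coordinates
  have hsum0 : lo₀ + hi₀ = C := by omega
  have hdiff0 : hi₀ - lo₀ ≤ H := by omega
  have ha2R : 0 ≤ a₂ * (R + av) := mul_nonneg (by linarith) (by linarith)
  have hH0 : 0 ≤ H := by rw [hH]; linarith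
  have hH1 : H ≤ 89 * n + 84 * R := by
    have : a₂ * (R + av) ≤ 42 * (R + n) := mul_le_mul ha2' (by linarith) (by linarith) (by norm_num)
    rw [hH]; linarith
  -- (2) width numerator `Ap − Am ≤ Δ·H + av·G ≤ 47·nΔ`
  have hG1 : G ≤ U * s + 2 * U := by
    have : U * P₀ ≤ U * (s + 1) := mul_le_mul_of_nonneg_left hP1 hU0.le
    rw [hG]; linarith
  have hW : Ap - Am ≤ Δ * H + av * G := by
    have : Δ * (hi₀ - lo₀) ≤ Δ * H := mul_le_mul_of_nonneg_left hdiff0 hΔ0.le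
    rw [hAp, hAm]; linarith
  have hnΔ : 0 < n * Δ := by positivity
  have hW' : Ap - Am ≤ 92 * (n * Δ) := by
    have h1 : Δ * H ≤ Δ * (89 * n + 84 * R) := mul_le_mul_of_nonneg_left hH1 hΔ0.le
    have h2 : av * G ≤ n * (U * s + 2 * U) := mul_le_mul havn hG1 hG0 hn0.le
    have h3 : Δ * (40 * K * R) ≤ Δ * n := mul_le_mul_of_nonneg_left hRn hΔ0.le
    have h3' : Δ * R * 84 ≤ Δ * (40 * K * R) := by
      have : 0 ≤ Δ * R * (40 * K - 84) := mul_nonneg (mul_nonneg hΔ0.le (by linarith)) (by linarith)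
      linarith
    have h4 : n * (U * s) ≤ n * Δ := mul_le_mul_of_nonneg_left hUs hn0.le
    have h5 : n * (958 * U) ≤ n * Δ := mul_le_mul_of_nonneg_left hUΔ hn0.le
    linarith
  -- (3) sum numerator
  have hC' : lo₀ + hi₀ = 2 * (N + 1) * v - 2 * v + a₁ * n := by rw [hsum0, hC]
  have hMs' : Mp + Mm = 2 * (v * (U * ((N + 1) * s + XY - P₀))) + v * (U * P₀ + U - 1) := by rw [hMs, hlo1, hG]
  have hSum : Am + Ap = 2 * ((N + 1) * v * (Δ - U * s)) + a₁ * (n * Δ) - 2 * (v * Δ) - 2 * (v * U * XY) + v * U * P₀ - v * U + v := by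
    rw [hAm, hAp]; linear_combination Δ * hC' - hMs'
  -- monomial bounds
  have hm1 : |(N + 1) * v * (Δ - U * s)| ≤ (N + 1) * n * (2 * U) := by
    rw [abs_mul, abs_mul, abs_of_nonneg (by linarith : (0 : ℤ) ≤ N + 1), abs_of_nonneg hd0]
    apply mul_le_mul (mul_le_mul_of_nonneg_left hvn0 (by linarith)) hd1 hd0
    positivity
  have hm1' : (N + 1) * n * (2 * U) ≤ 2 * (n * Δ) := by
    have h1 : (N + 1) * (2 * U) ≤ (21 * K + 3) * (2 * U) := mul_le_mul_of_nonneg_right (by linarith) (by linarith)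
    have h2 : (21 * K + 3) * (2 * U) ≤ 2 * Δ := by linarith
    have h3 := mul_le_mul_of_nonneg_left (h1.trans h2) hn0.le
    linarith
  have hm1abs := abs_le.1 (hm1.trans hm1')
  have hm2 : |v * U * XY| ≤ 22 * (n * Δ) := by
    rw [abs_mul, abs_mul, abs_of_nonneg hU0.le, abs_of_nonneg hXY0]
    have h4 : n * (U * s) ≤ n * Δ := mul_le_mul_of_nonneg_left hUs hn0.le
    calc |v| * U * XY ≤ n * U * (22 * s) := by
          apply mul_le_mul (mul_le_mul_of_nonneg_right hvn0 hU0.le) hXY hXY0 (by positivity)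
      _ = 22 * (n * (U * s)) := by ring
      _ ≤ 22 * (n * Δ) := by linarith
  have hm2abs := abs_le.1 hm2
  have hm3 : |v * U * P₀| ≤ n * Δ + n * U := by
    rw [abs_mul, abs_mul, abs_of_nonneg hU0.le, abs_of_nonneg (by linarith : (0 : ℤ) ≤ P₀)]
    have h4 : n * (U * s) ≤ n * Δ := mul_le_mul_of_nonneg_left hUs hn0.le
    calc |v| * U * P₀ ≤ n * U * (s + 1) := by
          apply mul_le_mul (mul_le_mul_of_nonneg_right hvn0 hU0.le) hP1 (by linarith) (by positivity)
      _ = n * (U * s) + n * U := by ring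
      _ ≤ n * Δ + n * U := by linarith
  have hm3abs := abs_le.1 hm3
  have hm4 : |v * Δ| ≤ n * Δ := by rw [abs_mul, abs_of_nonneg hΔ0.le]; exact mul_le_mul_of_nonneg_right hvn0 hΔ0.le
  have hm4abs := abs_le.1 hm4
  have hm5 : |v * U| ≤ n * U := by rw [abs_mul, abs_of_nonneg hU0.le]; exact mul_le_mul_of_nonneg_right hvn0 hU0.le
  have hm5abs := abs_le.1 hm5
  have hnU : 958 * (n * U) ≤ n * Δ := by have := mul_le_mul_of_nonneg_left hUΔ hn0.le; linarith
  have hvn : |v| ≤ n * Δ := hvn0.trans (le_mul_of_one_le_right hn0.le (by linarith))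
  have hvn' := abs_le.1 hvn
  have ha1lo : 194 * (n * Δ) ≤ a₁ * (n * Δ) := mul_le_mul_of_nonneg_right ha1 hnΔ.le
  have ha1hi : a₁ * (n * Δ) ≤ 198 * (n * Δ) := mul_le_mul_of_nonneg_right ha1' hnΔ.le
  -- sum bounds: `141·nΔ ≤ Am + Ap ≤ 251·nΔ`
  have hSlo : 141 * (n * Δ) ≤ Am + Ap := by rw [hSum]; linarith
  have hShi : Am + Ap ≤ 251 * (n * Δ) := by rw [hSum]; linarith
  -- (4) floors (hypotheses `hF1`–`hF4`)
  have hs0n : s₀ * n ≤ s₀ * (n * Δ) := mul_le_mul_of_nonneg_left (le_mul_of_one_le_right hn0.le (by linarith)) hs0p.le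
  have hs0nΔ : n * Δ ≤ s₀ * (n * Δ) := le_mul_of_one_le_left hnΔ.le hs0
  -- products of s₀ with the A-bounds
  have hW'' : s₀ * (Ap - Am) ≤ s₀ * (92 * (n * Δ)) := mul_le_mul_of_nonneg_left hW' hs0p.le
  have hSlo' : s₀ * (141 * (n * Δ)) ≤ s₀ * (Am + Ap) := mul_le_mul_of_nonneg_left hSlo hs0p.le
  have hShi' : s₀ * (Am + Ap) ≤ s₀ * (251 * (n * Δ)) := mul_le_mul_of_nonneg_left hShi hs0p.le
  have hKs : 100 * (s₀ * (n * Δ)) ≤ K * (s₀ * (n * Δ)) := mul_le_mul_of_nonneg_right hK (by positivity)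
  -- width, tight form: `nΔ·(Fp + 1 − Fm) < s₀(Ap − Am) + s₀·n + 2nΔ ≤ 95·s₀·nΔ`
  have key : n * Δ * (Fp + 1 - Fm) < n * Δ * (95 * s₀) := by linarith
  have := lt_of_mul_lt_mul_left key hnΔ.le
  linarith

/-! ## §2 The tight width at the tuple of record -/

section WidthY

variable (κ : Consts) {V : Type} [DecidableEq V] [Countable V] {G : SimpleGraph V} [G.LocallyFinite] (Φ : PlanarSkeletonFrm G) (t : V) (p : unitInterval)
  (D : Skelφ.StepI.DataNS V) (g f mk : ℕ)

/-- **THE x-READING OF THE (C) y′ ARRIVAL BOX IS NARROW**: `rdHi₀ − rdLo₀ ≤ 95·s₀ − 1` at the tuple of record (the landed `rd0Y_bounds_3` states the generous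
`≤ 152·s₀ − 3` — exactly the window `2·76·s₀`; its instantiation verbatim over the tight core `creepY_core3_width`). [this work] -/
theorem rd0Y_width_3 (hKq : 5 ≤ Neg.Kq κ) (hN : EqNumL κ Φ t p D g f) (hg : gFloorKG κ Φ t p D mk ≤ g) (hg2 : 40 * Neg.K κ * KS0.R'0 κ Φ t p D mk ≤ g) :
    rdHi (Aof κ) (nL κ Φ t p D g f) (hL κ Φ t p D g f) (vL κ Φ t p D g f) (vβL κ Φ t p D g f) (prFA κ Φ t p D g f).c₀ (prFA κ Φ t p D g f).c₁ (prFA κ Φ t p D g f).D (arrLoY3 κ Φ t p D g f mk) (arrHiY3 κ Φ t p D g f mk) 0 - rdLo (Aof κ) (nL κ Φ t p D g f) (hL κ Φ t p D g f) (vL κ Φ t p D g f) (vβL κ Φ t p D g f) (prFA κ Φ t p D g f).c₀ (prFA κ Φ t p D g f).c₁ (prFA κ Φ t p D g f).D (arrLoY3 κ Φ t p D g f mk) (arrHiY3 κ Φ t p D g f mk) 0 ≤ 95 * (((fcellsA κ Φ t p D g f).s 0 : ℕ) : ℤ) - 1 := by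
  -- the tuple's facts
  obtain ⟨hsc0, -, hn1, hA0, hDp, hm, -, -, hkq, -⟩ := hsc_Q κ Φ t p D g f hN
  obtain ⟨hnR', hs40, hbig, hR1, -, -⟩ := valsQ_floor κ Φ t p D g f mk hN hg hg2
  have hUs := UsL_le_modulus κ Φ t p D g f hN
  have hNle : (((kgNYv0 κ Φ t p D g f mk (qxYQ4 κ Φ t p D g f) (WxYQ4 κ Φ t p D g f)) : ℕ) : ℤ) ≤ 21 * (((Neg.K κ : ℕ) : ℤ)) + 2 := by exact_mod_cast kgNYv0_le κ Φ t p D g f mk (qxYQ4 κ Φ t p D g f) (WxYQ4 κ Φ t p D g f) hN hg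
  have H := kgYRows0_of κ Φ t p D g f mk (qxYQ4 κ Φ t p D g f) (WxYQ4 κ Φ t p D g f) hN hg
  obtain ⟨-, hE2, hE3⟩ := H.kgE₁Y_spec (kgNYv0 κ Φ t p D g f mk (qxYQ4 κ Φ t p D g f) (WxYQ4 κ Φ t p D g f))
  have hv := hN.v_le
  have hd1eq := (dec₁Y_eq_Q κ Φ t p D g f mk).1
  obtain ⟨ha1lo, ha1hi⟩ := a1Y_bounds_3 κ Φ t p D g f mk hKq hN hg hg2 (kgNYv0 κ Φ t p D g f mk (qxYQ4 κ Φ t p D g f) (WxYQ4 κ Φ t p D g f)) hNle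
  obtain ⟨ha2lo, ha2hi⟩ := a2Y_le_3 κ Φ t p D g f mk hKq hN hg hg2 (kgNYv0 κ Φ t p D g f mk (qxYQ4 κ Φ t p D g f) (WxYQ4 κ Φ t p D g f)) hNle
  obtain ⟨hXY0, hXYle⟩ := XY_le_3 κ Φ t p D g f mk hKq hN hg hg2 (kgNYv0 κ Φ t p D g f mk (qxYQ4 κ Φ t p D g f) (WxYQ4 κ Φ t p D g f)) hNle
  have hCeq := kgCtr2Y_eq_zero H (kgNYv0 κ Φ t p D g f mk (qxYQ4 κ Φ t p D g f) (WxYQ4 κ Φ t p D g f))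
  have hHeq := kgHw2Y_eq_zero (nL κ Φ t p D g f) (ℓL κ Φ t p D g f) (hL κ Φ t p D g f) (vL κ Φ t p D g f) (kgR κ Φ t p D mk) (kgqY κ Φ t p D g f (qxYQ4 κ Φ t p D g f)) (kgWY κ Φ t p D g f (WxYQ4 κ Φ t p D g f)) (kgNYv0 κ Φ t p D g f mk (qxYQ4 κ Φ t p D g f) (WxYQ4 κ Φ t p D g f))
  have hP0 := kgSL_le_natDiv κ Φ t p D g f hN
  have hP1 := Skelφ.natDiv_le_kgSLY hn1 (ℓL κ Φ t p D g f) (hL κ Φ t p D g f)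
  have hP0nat : (((nL κ Φ t p D g f) * (ℓL κ Φ t p D g f) / (shearUnit (nL κ Φ t p D g f) (hL κ Φ t p D g f)) : ℕ) : ℤ) = (((nL κ Φ t p D g f) : ℕ) : ℤ) * (ℓL κ Φ t p D g f) / ((shearUnit (nL κ Φ t p D g f) (hL κ Φ t p D g f)) : ℕ) := by push_cast; rfl
  rw [hP0nat] at hP0 hP1
  rw [kgSLY_eq_kgSL] at hP1
  have h80 : 80 ≤ Neg.K κ := by have := Neg.K_eq κ; omega
  have hK80 : (80 : ℤ) ≤ (((Neg.K κ : ℕ) : ℤ)) := by exact_mod_cast h80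
  have hRR : ((KS0.R'0 κ Φ t p D mk : ℕ) : ℤ) = (((kgR κ Φ t p D mk) : ℕ) : ℤ) := rfl
  rw [hRR] at hnR' hR1 hs40
  have hR0 : (0 : ℤ) ≤ (((kgR κ Φ t p D mk) : ℕ) : ℤ) := by linarith
  have hn0 : (0 : ℤ) < (((nL κ Φ t p D g f) : ℕ) : ℤ) := by exact_mod_cast hn1
  have hn1z : (1 : ℤ) ≤ (((nL κ Φ t p D g f) : ℕ) : ℤ) := by exact_mod_cast hn1
  have hA1 : 1 ≤ Aof κ := by linarith
  have hs0one : (1 : ℤ) ≤ ((((fcellsA κ Φ t p D g f).s 0 : ℕ) : ℤ)) := by exact_mod_cast (fcellsA κ Φ t p D g f).hs 0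
  have hs0p : (0 : ℤ) < ((((fcellsA κ Φ t p D g f).s 0 : ℕ) : ℤ)) := by linarith
  -- `Δ ≤ nℓ ≤ U·sL + 2U − 2`, `n ≤ U`
  have hmod := (Skelφ.NegPrm.modulus_vβOf hn1 (hL κ Φ t p D g f) (ℓL κ Φ t p D g f) (vL κ Φ t p D g f)).2
  have hvβ : vβL κ Φ t p D g f = Skelφ.NegPrm.vβOf (nL κ Φ t p D g f) (hL κ Φ t p D g f) (ℓL κ Φ t p D g f) (vL κ Φ t p D g f) := rfl
  rw [← hvβ] at hmod
  have hU : (0 : ℤ) < ((shearUnit (nL κ Φ t p D g f) (hL κ Φ t p D g f)) : ℕ) := Skelφ.shearUnit_pos hn1 _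
  have hUn : (((nL κ Φ t p D g f) : ℕ) : ℤ) ≤ ((shearUnit (nL κ Φ t p D g f) (hL κ Φ t p D g f)) : ℕ) := by rw [shearUnit_cast]; linarith [abs_nonneg (hL κ Φ t p D g f)]
  have hΔU : (modulus (nL κ Φ t p D g f) (hL κ Φ t p D g f) (vL κ Φ t p D g f) (vβL κ Φ t p D g f)) ≤ (((shearUnit (nL κ Φ t p D g f) (hL κ Φ t p D g f)) : ℕ) : ℤ) * (kgSL (nL κ Φ t p D g f) (ℓL κ Φ t p D g f) (hL κ Φ t p D g f)) + 2 * (((shearUnit (nL κ Φ t p D g f) (hL κ Φ t p D g f)) : ℕ) : ℤ) := by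
    have hfl := Int.lt_mul_ediv_self_add (x := (((nL κ Φ t p D g f) : ℕ) : ℤ) * (ℓL κ Φ t p D g f) - ((shearUnit (nL κ Φ t p D g f) (hL κ Φ t p D g f)) : ℕ) + 1) hU
    unfold Skelφ.kgSL; linarith
  -- `c₀′·A·Δ = s₀·D`
  have hr0 : ((((fcellsA κ Φ t p D g f).r 0 : ℕ) : ℤ)) = 40 * ((Neg.Kq κ : ℕ) : ℤ) * ((((fcellsA κ Φ t p D g f).s 0 : ℕ) : ℤ)) := by
    rw [PCells2.r_eq, show ((fcellsA κ Φ t p D g f).K : ℤ) = Neg.K κ by exact_mod_cast (fcellsA_K κ Φ t p D g f).1,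
      show (((Neg.K κ : ℕ) : ℤ)) = 40 * ((Neg.Kq κ : ℕ) : ℤ) by exact_mod_cast Neg.K_eq κ]
  have e0 : (prFA κ Φ t p D g f).c₀ * Aof κ * (modulus (nL κ Φ t p D g f) (hL κ Φ t p D g f) (vL κ Φ t p D g f) (vβL κ Φ t p D g f)) = ((((fcellsA κ Φ t p D g f).s 0 : ℕ) : ℤ)) * (prFA κ Φ t p D g f).D := by
    rw [hr0] at hsc0
    have h' : (40 * ((Neg.Kq κ : ℕ) : ℤ)) * ((prFA κ Φ t p D g f).c₀ * Aof κ * (modulus (nL κ Φ t p D g f) (hL κ Φ t p D g f) (vL κ Φ t p D g f) (vβL κ Φ t p D g f))) = (40 * ((Neg.Kq κ : ℕ) : ℤ)) * (((((fcellsA κ Φ t p D g f).s 0 : ℕ) : ℤ)) * (prFA κ Φ t p D g f).D) := by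
      linear_combination hsc0
    have h40 : (40 * ((Neg.Kq κ : ℕ) : ℤ)) ≠ 0 := by positivity
    exact mul_left_cancel₀ h40 h'
  -- the box rows and the `/2` facts
  obtain ⟨elo0, ehi0, elo1, ehi1⟩ := arrY3_apply κ Φ t p D g f mk
  have hbox : kgCtr2Y (nL κ Φ t p D g f) (vL κ Φ t p D g f) (kgR κ Φ t p D mk) 0 (kgWY κ Φ t p D g f (WxYQ4 κ Φ t p D g f)) (kgNYv0 κ Φ t p D g f mk (qxYQ4 κ Φ t p D g f) (WxYQ4 κ Φ t p D g f)) - kgHw2Y (nL κ Φ t p D g f) (ℓL κ Φ t p D g f) (hL κ Φ t p D g f) (vL κ Φ t p D g f) (kgR κ Φ t p D mk) 0 (kgqY κ Φ t p D g f (qxYQ4 κ Φ t p D g f)) (kgWY κ Φ t p D g f (WxYQ4 κ Φ t p D g f)) (kgNYv0 κ Φ t p D g f mk (qxYQ4 κ Φ t p D g f) (WxYQ4 κ Φ t p D g f)) ≤ 2 * arrLoY3 κ Φ t p D g f mk 0 ∧ 2 * arrLoY3 κ Φ t p D g f mk 0 ≤ kgCtr2Y (nL κ Φ t p D g f) (vL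 κ Φ t p D g f) (kgR κ Φ t p D mk) 0 (kgWY κ Φ t p D g f (WxYQ4 κ Φ t p D g f)) (kgNYv0 κ Φ t p D g f mk (qxYQ4 κ Φ t p D g f) (WxYQ4 κ Φ t p D g f)) - kgHw2Y (nL κ Φ t p D g f) (ℓL κ Φ t p D g f) (hL κ Φ t p D g f) (vL κ Φ t p D g f) (kgR κ Φ t p D mk) 0 (kgqY κ Φ t p D g f (qxYQ4 κ Φ t p D g f)) (kgWY κ Φ t p D g f (WxYQ4 κ Φ t p D g f)) (kgNYv0 κ Φ t p D g f mk (qxYQ4 κ Φ t p D g f) (WxYQ4 κ Φ t p D g f)) + 1 ∧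
      2 * arrHiY3 κ Φ t p D g f mk 0 ≤ kgCtr2Y (nL κ Φ t p D g f) (vL κ Φ t p D g f) (kgR κ Φ t p D mk) 0 (kgWY κ Φ t p D g f (WxYQ4 κ Φ t p D g f)) (kgNYv0 κ Φ t p D g f mk (qxYQ4 κ Φ t p D g f) (WxYQ4 κ Φ t p D g f)) + kgHw2Y (nL κ Φ t p D g f) (ℓL κ Φ t p D g f) (hL κ Φ t p D g f) (vL κ Φ t p D g f) (kgR κ Φ t p D mk) 0 (kgqY κ Φ t p D g f (qxYQ4 κ Φ t p D g f)) (kgWY κ Φ t p D g f (WxYQ4 κ Φ t p D g f)) (kgNYv0 κ Φ t p D g f mk (qxYQ4 κ Φ t p D g f) (WxYQ4 κ Φ t p D g f)) ∧ kgCtr2Y (nL κ Φ t p D g f) (vL κ Φ t p D g f) (kgR κ Φ t p D mk) 0 (kgWY κ Φ t p D g f (WxYQ4 κ Φ t p D g f)) (kgNYv0 κ Φ t p D g f mk (qxYQ4 κ Φ t p D g f) (WxYQ4 κ Φ t p D g f)) + kgHw2Y (nL κ Φ t p D g f) (ℓL κ Φ t p D g f) (hL κ Φ t p D g f) (vL κ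 Φ t p D g f) (kgR κ Φ t p D mk) 0 (kgqY κ Φ t p D g f (qxYQ4 κ Φ t p D g f)) (kgWY κ Φ t p D g f (WxYQ4 κ Φ t p D g f)) (kgNYv0 κ Φ t p D g f mk (qxYQ4 κ Φ t p D g f) (WxYQ4 κ Φ t p D g f)) - 1 ≤ 2 * arrHiY3 κ Φ t p D g f mk 0 := by
    rw [elo0, ehi0]; omega
  have hlo1 : arrLoY3 κ Φ t p D g f mk 1 = ((((kgNYv0 κ Φ t p D g f mk (qxYQ4 κ Φ t p D g f) (WxYQ4 κ Φ t p D g f)) : ℕ) : ℤ) + 1) * (kgSL (nL κ Φ t p D g f) (ℓL κ Φ t p D g f) (hL κ Φ t p D g f)) + kgXY (nL κ Φ t p D g f) (ℓL κ Φ t p D g f) (hL κ Φ t p D g f) (vL κ Φ t p D g f) (kgR κ Φ t p D mk) 0 (kgqY κ Φ t p D g f (qxYQ4 κ Φ t p D g f)) (kgWY κ Φ t p D g f (WxYQ4 κ Φ t p D g f)) (kgNYv0 κ Φ t p D g f mk (qxYQ4 κ Φ t p D g f) (WxYQ4 κ Φ t p D g f)) - (((nL κ Φ t p D g f) : ℕ)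 : ℤ) * (ℓL κ Φ t p D g f) / ((shearUnit (nL κ Φ t p D g f) (hL κ Φ t p D g f)) : ℕ) := by
    rw [elo1, kgSLY_eq_kgSL]; push_cast; ring
  have hT2 : (vL κ Φ t p D g f) * ((((shearUnit (nL κ Φ t p D g f) (hL κ Φ t p D g f)) : ℕ) : ℤ) * arrHiY3 κ Φ t p D g f mk 1 + (((shearUnit (nL κ Φ t p D g f) (hL κ Φ t p D g f)) : ℕ) : ℤ) - 1) = (vL κ Φ t p D g f) * ((((shearUnit (nL κ Φ t p D g f) (hL κ Φ t p D g f)) : ℕ) : ℤ) * arrLoY3 κ Φ t p D g f mk 1) + (vL κ Φ t p D g f) * ((((shearUnit (nL κ Φ t p D g f) (hL κ Φ t p D g f)) : ℕ) : ℤ) * ((((nL κ Φ t p D g f) : ℕ) : ℤ) * (ℓL κ Φ t p D g f) / ((shearUnit (nL κ Φ t p D g f) (hL κ Φ t p D g f)) : ℕ)) + (((shearUnit (nL κ Φ t p D g f) (hL κ Φ t p D g f)) : ℕ) : ℤ) - 1) := by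
    rw [ehi1, elo1]; push_cast; ring
  -- the readings as nested floors
  rw [Skelφ.rdLo_zero, Skelφ.rdHi_zero]
  set Zm := ((modulus (nL κ Φ t p D g f) (hL κ Φ t p D g f) (vL κ Φ t p D g f) (vβL κ Φ t p D g f)) * arrLoY3 κ Φ t p D g f mk 0 - max ((vL κ Φ t p D g f) * ((((shearUnit (nL κ Φ t p D g f) (hL κ Φ t p D g f)) : ℕ) : ℤ) * arrLoY3 κ Φ t p D g f mk 1)) ((vL κ Φ t p D g f) * ((((shearUnit (nL κ Φ t p D g f) (hL κ Φ t p D g f)) : ℕ) : ℤ) * arrHiY3 κ Φ t p D g f mk 1 + (((shearUnit (nL κ Φ t p D g f) (hL κ Φ t p D g f)) : ℕ) : ℤ) - 1))) with hZm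
  set Zp := ((modulus (nL κ Φ t p D g f) (hL κ Φ t p D g f) (vL κ Φ t p D g f) (vβL κ Φ t p D g f)) * arrHiY3 κ Φ t p D g f mk 0 - min ((vL κ Φ t p D g f) * ((((shearUnit (nL κ Φ t p D g f) (hL κ Φ t p D g f)) : ℕ) : ℤ) * arrLoY3 κ Φ t p D g f mk 1)) ((vL κ Φ t p D g f) * ((((shearUnit (nL κ Φ t p D g f) (hL κ Φ t p D g f)) : ℕ) : ℤ) * arrHiY3 κ Φ t p D g f mk 1 + (((shearUnit (nL κ Φ t p D g f) (hL κ Φ t p D g f)) : ℕ) : ℤ) - 1))) with hZp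
  have hqm := Int.mul_ediv_self_le (x := Aof κ * Zm) (ne_of_gt hn0)
  have hqm' := Int.lt_mul_ediv_self_add (x := Aof κ * Zm) hn0
  have hqp := Int.mul_ediv_self_le (x := Aof κ * Zp) (ne_of_gt hn0)
  have hqp' := Int.lt_mul_ediv_self_add (x := Aof κ * Zp) hn0
  have hFm := Int.mul_ediv_self_le (x := (prFA κ Φ t p D g f).c₀ * (Aof κ * Zm / (((nL κ Φ t p D g f) : ℕ) : ℤ))) (ne_of_gt hDp)
  have hFm' := Int.lt_mul_ediv_self_add (x := (prFA κ Φ t p D g f).c₀ * (Aof κ * Zm / (((nL κ Φ t p D g f) : ℕ) : ℤ))) hDp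
  have hFp := Int.mul_ediv_self_le (x := (prFA κ Φ t p D g f).c₀ * (Aof κ * Zp / (((nL κ Φ t p D g f) : ℕ) : ℤ))) (ne_of_gt hDp)
  have hFp' := Int.lt_mul_ediv_self_add (x := (prFA κ Φ t p D g f).c₀ * (Aof κ * Zp / (((nL κ Φ t p D g f) : ℕ) : ℤ))) hDp
  obtain ⟨-, hF2⟩ := floorA_bounds hA1 hn0 hm hs0p hDp e0 hqm hqm' hFm hFm'
  obtain ⟨hF3, -⟩ := floorA_bounds hA1 hn0 hm hs0p hDp e0 hqp hqp' hFp hFp'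
  have hE5 : ((kgE₁Y (nL κ Φ t p D g f) (vL κ Φ t p D g f) (kgR κ Φ t p D mk) 0 (kgWY κ Φ t p D g f (WxYQ4 κ Φ t p D g f)) (kgNYv0 κ Φ t p D g f mk (qxYQ4 κ Φ t p D g f) (WxYQ4 κ Φ t p D g f)) : ℕ) : ℤ) ≤ 5 * (((nL κ Φ t p D g f) : ℕ) : ℤ) := by linarith [abs_nonneg (vL κ Φ t p D g f)]
  have hK100 : (100 : ℤ) ≤ (((Neg.K κ : ℕ) : ℤ)) := by
    have h100 : 100 ≤ Neg.K κ := by have := Neg.K_eq κ; omega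
    exact_mod_cast h100
  exact creepY_core3_width (hn := hn1z) (hUn := hUn) (hUs := hUs) (hΔU := hΔU) (hs := hbig) (hK := hK100) (hR := hR1) (hKR := hs40) (hnR := hnR')
    (hav0 := abs_nonneg _) (havn := hv) (hv1 := le_abs_self _) (hv2 := neg_le_abs _) (hN0 := Nat.cast_nonneg _) (hN := hNle)
    (ha1 := ha1lo) (ha1' := ha1hi) (ha2 := ha2lo) (ha2' := ha2hi) (hE0 := hE2) (hE1 := hE5) (hXY0 := hXY0) (hXY := hXYle)
    (hP0 := hP0) (hP1 := hP1) (hH := hHeq) (hC := hCeq) (hlo0 := hbox.1) (hlo0' := hbox.2.1) (hhi0 := hbox.2.2.1) (hhi0' := hbox.2.2.2)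
    (hlo1 := hlo1) (hG := rfl) (hT₁ := rfl) (hT₂ := hT2) (hAm := hZm) (hAp := hZp) (hs0 := hs0one) (hF2 := hF2) (hF3 := hF3)

end WidthY

/-! ## §3 Widening a box moves the axis-0 readings by whole fine cells -/

section Shift

variable {A : ℤ} {n : ℕ} {h vα vβ c₀' c₁' D : ℤ} {lo hi lo' hi' : Site 2} {e k : ℤ}

/-- **Lower axis-0 reading of a widened box**: if the de-sheared lower corner drops by at most `n·e` and `c₀'·A·e = k·D`, then `rdLo₀` drops by at most `k`
(floors: `⌊A(Z − n e)/n⌋ = ⌊AZ/n⌋ − A e`, `⌊(c₀'q − kD)/D⌋ = ⌊c₀'q/D⌋ − k`). [folklore] -/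
theorem rdLo_zero_widen (hn : 1 ≤ n) (hA : 0 ≤ A) (hD : 0 < D) (hc₀ : 0 ≤ c₀')
    (hZ : modulus n h vα vβ * lo 0 - max (vα * ((shearUnit n h : ℤ) * lo 1)) (vα * ((shearUnit n h : ℤ) * hi 1 + shearUnit n h - 1)) - n * e ≤
      modulus n h vα vβ * lo' 0 - max (vα * ((shearUnit n h : ℤ) * lo' 1)) (vα * ((shearUnit n h : ℤ) * hi' 1 + shearUnit n h - 1)))
    (hk : c₀' * (A * e) = k * D) :
    rdLo A n h vα vβ c₀' c₁' D lo hi 0 - k ≤ rdLo A n h vα vβ c₀' c₁' D lo' hi' 0 := by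
  rw [Skelφ.rdLo_zero, Skelφ.rdLo_zero]
  generalize modulus n h vα vβ * lo 0 - max (vα * ((shearUnit n h : ℤ) * lo 1)) (vα * ((shearUnit n h : ℤ) * hi 1 + shearUnit n h - 1)) = Z at hZ
  generalize modulus n h vα vβ * lo' 0 - max (vα * ((shearUnit n h : ℤ) * lo' 1)) (vα * ((shearUnit n h : ℤ) * hi' 1 + shearUnit n h - 1)) = Z' at hZ
  have hn0 : (0 : ℤ) < n := by exact_mod_cast hn
  have h1 : A * Z + -(A * e) * n ≤ A * Z' := by
    have := mul_le_mul_of_nonneg_left hZ hA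
    have e1 : A * (Z - n * e) = A * Z + -(A * e) * n := by ring
    linarith
  have h2 : (A * Z + -(A * e) * n) / n ≤ A * Z' / n := Int.ediv_le_ediv hn0 h1
  rw [Int.add_mul_ediv_right _ _ (ne_of_gt hn0)] at h2
  have h3 : c₀' * (A * Z / n) + -k * D ≤ c₀' * (A * Z' / n) := by
    have := mul_le_mul_of_nonneg_left h2 hc₀
    have e2 : c₀' * (A * Z / n + -(A * e)) = c₀' * (A * Z / n) - c₀' * (A * e) := by ring
    linarith
  have h4 : (c₀' * (A * Z / n) + -k * D) / D ≤ c₀' * (A * Z' / n) / D := Int.ediv_le_ediv hD h3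
  rw [Int.add_mul_ediv_right _ _ (ne_of_gt hD)] at h4
  linarith

/-- **Upper axis-0 reading of a widened box**: if the de-sheared upper corner rises by at most `n·e` and `c₀'·A·e = k·D`, then `rdHi₀` rises by at most `k`.
[folklore] -/
theorem rdHi_zero_widen (hn : 1 ≤ n) (hA : 0 ≤ A) (hD : 0 < D) (hc₀ : 0 ≤ c₀')
    (hZ : modulus n h vα vβ * hi' 0 - min (vα * ((shearUnit n h : ℤ) * lo' 1)) (vα * ((shearUnit n h : ℤ) * hi' 1 + shearUnit n h - 1)) ≤
      modulus n h vα vβ * hi 0 - min (vα * ((shearUnit n h : ℤ) * lo 1)) (vα * ((shearUnit n h : ℤ) * hi 1 + shearUnit n h - 1)) + n * e)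
    (hk : c₀' * (A * e) = k * D) :
    rdHi A n h vα vβ c₀' c₁' D lo' hi' 0 ≤ rdHi A n h vα vβ c₀' c₁' D lo hi 0 + k := by
  rw [Skelφ.rdHi_zero, Skelφ.rdHi_zero]
  generalize modulus n h vα vβ * hi 0 - min (vα * ((shearUnit n h : ℤ) * lo 1)) (vα * ((shearUnit n h : ℤ) * hi 1 + shearUnit n h - 1)) = Z at hZ
  generalize modulus n h vα vβ * hi' 0 - min (vα * ((shearUnit n h : ℤ) * lo' 1)) (vα * ((shearUnit n h : ℤ) * hi' 1 + shearUnit n h - 1)) = Z' at hZ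
  have hn0 : (0 : ℤ) < n := by exact_mod_cast hn
  have h1 : A * Z' ≤ A * Z + (A * e) * n := by
    have := mul_le_mul_of_nonneg_left hZ hA
    have e1 : A * (Z + n * e) = A * Z + (A * e) * n := by ring
    linarith
  have h2 : A * Z' / n ≤ (A * Z + (A * e) * n) / n := Int.ediv_le_ediv hn0 h1
  rw [Int.add_mul_ediv_right _ _ (ne_of_gt hn0)] at h2
  have h3 : c₀' * (A * Z' / n) ≤ c₀' * (A * Z / n) + k * D := by
    have := mul_le_mul_of_nonneg_left h2 hc₀
    have e2 : c₀' * (A * Z / n + A * e) = c₀' * (A * Z / n) + c₀' * (A * e) := by ring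
    linarith
  have h4 : c₀' * (A * Z' / n) / D ≤ (c₀' * (A * Z / n) + k * D) / D := Int.ediv_le_ediv hD h3
  rw [Int.add_mul_ediv_right _ _ (ne_of_gt hD)] at h4
  linarith

end Shift

end NegB

end PlanarSkeletonFrm

end Summit.CriticalPhenomena.PercolationContinuityZ3.Theorems.Transplant

end
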